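import Mathlib.CategoryTheory.Monoidal.Cartesian.Grp
import HarnessLib

/-!
# A group object from an associative law with invertible shear maps and a point (first rung of Weil's group-chunk theorem)
# — [Edixhoven–Romagny 2012, Thm. 2.11 (2)–(5) / 3.28 (2)–(4)] [Artin 1986, §2, after Lemma 2.5] [BLRNeronModels1990, §5.1]

Topic `Literature/AlgebraicGeometry/NeronModels`; THEOREMS ONLY (no definition, no named fact, no instance, no notation; net
Literature debt 0).  Cell `hodgecm-mathlib` (D-0151), road W = r₀ as a theorem, node (W1) «group scheme out of a strict
birational group law», FIRST RUNG (A-p06 READFIRST-W1 §0.4 / §3 W1d): the purely categorical end of the argument, valid in ANY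
cartesian monoidal category `C` (for `C = Over (Spec R)`: group SCHEMES over `R`).

**`exists_grpObj_of_isIso_shear`.**  Let `m : X ⊗ X ⟶ X` be a law which is ASSOCIATIVE on `T`-points, whose two SHEAR maps
`Φ = (pr₁, m)` and `Ψ = (m, pr₂) : X ⊗ X ⟶ X ⊗ X` are ISOMORPHISMS (left and right translations everywhere defined and bijective —
for an everywhere-defined strict birational group law on a proper smooth `𝒳` both are open immersions between proper schemes
with irreducible fibres, hence isomorphisms), and which has a POINT `p : 𝟙 ⟶ X`.  Then `X` carries a group-object structure with
multiplication `m`.  Proof: on `T`-points `m` is an associative QUASIGROUP law (divisions read off `Φ⁻¹`, `Ψ⁻¹`); an associative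
quasigroup with an element is a group (`e :=` the solution of `p·e = p` is a two-sided unit, `a⁻¹ :=` the solution of
`a·x = e`); naturally in `T`, so `X` represents a presheaf of groups (Mathlib `GrpObj.ofRepresentableBy`).

HC_CM is proved only modulo the 7 printed citations until rung 0 closes.
-/

set_option autoImplicit false

noncomputable section

open CategoryTheory MonoidalCategory CartesianMonoidalCategory Opposite

universe v u

namespace Literature.AlgebraicGeometry.NeronModels

variable {C : Type u} [Category.{v} C] [CartesianMonoidalCategory C] {X : C} {m : X ⊗ X ⟶ X}

/-! ### Quasigroup identities on `T`-points from the shear isomorphisms -/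

/-- `(a, a·b) = (a, b) ≫ Φ` for the left shear `Φ = (pr₁, m)`. [cite: EdixhovenRomagny2012, Thm. 2.11] -/
private theorem lift_mul_eq_comp_shearLeft {T : C} (a b : T ⟶ X) :
    lift a (lift a b ≫ m) = lift a b ≫ lift (fst X X) m := by
  rw [comp_lift, lift_fst]

/-- `(a·b, b) = (a, b) ≫ Ψ` for the right shear `Ψ = (m, pr₂)`. [cite: EdixhovenRomagny2012, Thm. 2.11] -/
private theorem lift_mul_eq_comp_shearRight {T : C} (a b : T ⟶ X) :
    lift (lift a b ≫ m) b = lift a b ≫ lift m (snd X X) := by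
  rw [comp_lift, lift_snd]

/-- Left division `a ∖ c := pr₂ (Φ⁻¹ (a, c))` solves `a · (a ∖ c) = c`. [cite: EdixhovenRomagny2012, Thm. 2.11] -/
private theorem mul_ldiv [IsIso (lift (fst X X) m)] {T : C} (a c : T ⟶ X) :
    lift a (lift a c ≫ inv (lift (fst X X) m) ≫ snd X X) ≫ m = c := by
  set y := lift a c ≫ inv (lift (fst X X) m) with hy
  have h : y ≫ lift (fst X X) m = lift a c := by rw [hy, Category.assoc, IsIso.inv_hom_id, Category.comp_id]
  rw [comp_lift] at h
  have h1 : y ≫ fst X X = a := by simpa using congrArg (· ≫ fst X X) h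
  have h2 : y ≫ m = c := by simpa using congrArg (· ≫ snd X X) h
  have hy' : y = lift a (y ≫ snd X X) := by
    apply CartesianMonoidalCategory.hom_ext <;> simp [h1]
  rw [← Category.assoc, ← hy, ← h2]
  exact congrArg (· ≫ m) hy'.symm

/-- Left division is determined: `a ∖ (a · b) = b`. [cite: EdixhovenRomagny2012, Thm. 2.11] -/
private theorem ldiv_mul [IsIso (lift (fst X X) m)] {T : C} (a b : T ⟶ X) :
    lift a (lift a b ≫ m) ≫ inv (lift (fst X X) m) ≫ snd X X = b := by
  rw [lift_mul_eq_comp_shearLeft, Category.assoc, IsIso.hom_inv_id_assoc, lift_snd]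

/-- Right division `c ⁄ b := pr₁ (Ψ⁻¹ (c, b))` solves `(c ⁄ b) · b = c`. [cite: EdixhovenRomagny2012, Thm. 2.11] -/
private theorem rdiv_mul [IsIso (lift m (snd X X))] {T : C} (c b : T ⟶ X) :
    lift (lift c b ≫ inv (lift m (snd X X)) ≫ fst X X) b ≫ m = c := by
  set y := lift c b ≫ inv (lift m (snd X X)) with hy
  have h : y ≫ lift m (snd X X) = lift c b := by rw [hy, Category.assoc, IsIso.inv_hom_id, Category.comp_id]
  rw [comp_lift] at h
  have h1 : y ≫ snd X X = b := by simpa using congrArg (· ≫ snd X X) h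
  have h2 : y ≫ m = c := by simpa using congrArg (· ≫ fst X X) h
  have hy' : y = lift (y ≫ fst X X) b := by
    apply CartesianMonoidalCategory.hom_ext <;> simp [h1]
  rw [← Category.assoc, ← hy, ← h2]
  exact congrArg (· ≫ m) hy'.symm

/-- Right division is determined: `(a · b) ⁄ b = a`. [cite: EdixhovenRomagny2012, Thm. 2.11] -/
private theorem mul_rdiv [IsIso (lift m (snd X X))] {T : C} (a b : T ⟶ X) :
    lift (lift a b ≫ m) b ≫ inv (lift m (snd X X)) ≫ fst X X = a := by
  rw [lift_mul_eq_comp_shearRight, Category.assoc, IsIso.hom_inv_id_assoc, lift_fst]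

/-! ### Unit and inverse on `T`-points (an associative quasigroup with an element is a group) -/

section Unit

variable [IsIso (lift (fst X X) m)] [IsIso (lift m (snd X X))]
  (hassoc : ∀ {T : C} (a b c : T ⟶ X), lift (lift a b ≫ m) c ≫ m = lift a (lift b c ≫ m) ≫ m) (p : 𝟙_ C ⟶ X)
include hassoc

/-- Right unit: with `e := p ∖ p` (so `p · e = p`), `a · e = a` — write `a = (a ⁄ p) · p` and use associativity.
[cite: EdixhovenRomagny2012, Thm. 2.11 (2)] -/
private theorem mul_unit {T : C} (a : T ⟶ X) :
    lift a (lift (toUnit T ≫ p) (toUnit T ≫ p) ≫ inv (lift (fst X X) m) ≫ snd X X) ≫ m = a := by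
  have h1 := rdiv_mul (m := m) a (toUnit T ≫ p)
  calc lift a (lift (toUnit T ≫ p) (toUnit T ≫ p) ≫ inv (lift (fst X X) m) ≫ snd X X) ≫ m
      = lift (lift (lift a (toUnit T ≫ p) ≫ inv (lift m (snd X X)) ≫ fst X X) (toUnit T ≫ p) ≫ m)
          (lift (toUnit T ≫ p) (toUnit T ≫ p) ≫ inv (lift (fst X X) m) ≫ snd X X) ≫ m := by rw [h1]
    _ = lift (lift a (toUnit T ≫ p) ≫ inv (lift m (snd X X)) ≫ fst X X) (toUnit T ≫ p) ≫ m := by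
          rw [hassoc, mul_ldiv]
    _ = a := h1

/-- Left unit: `e · a = a` (the left unit `p ⁄ p` equals the right unit `p ∖ p`). [cite: EdixhovenRomagny2012, Thm. 2.11 (2)] -/
private theorem unit_mul {T : C} (a : T ⟶ X) :
    lift (lift (toUnit T ≫ p) (toUnit T ≫ p) ≫ inv (lift (fst X X) m) ≫ snd X X) a ≫ m = a := by
  -- the left unit `e' := p ⁄ p` satisfies `e' · b = b`
  have hl : ∀ b : T ⟶ X,
      lift (lift (toUnit T ≫ p) (toUnit T ≫ p) ≫ inv (lift m (snd X X)) ≫ fst X X) b ≫ m = b := fun b => by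
    have h1 := mul_ldiv (m := m) (toUnit T ≫ p) b
    calc lift (lift (toUnit T ≫ p) (toUnit T ≫ p) ≫ inv (lift m (snd X X)) ≫ fst X X) b ≫ m
        = lift (lift (toUnit T ≫ p) (toUnit T ≫ p) ≫ inv (lift m (snd X X)) ≫ fst X X)
            (lift (toUnit T ≫ p) (lift (toUnit T ≫ p) b ≫ inv (lift (fst X X) m) ≫ snd X X) ≫ m) ≫ m := by rw [h1]
      _ = b := by rw [← hassoc, rdiv_mul, h1]
  -- `e' = e' · e = e`
  have he : lift (toUnit T ≫ p) (toUnit T ≫ p) ≫ inv (lift m (snd X X)) ≫ fst X X =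
      lift (toUnit T ≫ p) (toUnit T ≫ p) ≫ inv (lift (fst X X) m) ≫ snd X X := by
    rw [← mul_unit hassoc p (lift (toUnit T ≫ p) (toUnit T ≫ p) ≫ inv (lift m (snd X X)) ≫ fst X X), hl]
  rw [← he]
  exact hl a

/-- Left inverse: with `a⁻¹ := a ∖ e`, `a⁻¹ · a = e` (from `(a⁻¹ a) a⁻¹ = a⁻¹ (a a⁻¹) = a⁻¹ = e a⁻¹` and right cancellation).
[cite: EdixhovenRomagny2012, Thm. 2.11 (2)] -/
private theorem linv_mul {T : C} (a : T ⟶ X) :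
    lift (lift a (lift (toUnit T ≫ p) (toUnit T ≫ p) ≫ inv (lift (fst X X) m) ≫ snd X X) ≫ inv (lift (fst X X) m) ≫ snd X X)
        a ≫ m = lift (toUnit T ≫ p) (toUnit T ≫ p) ≫ inv (lift (fst X X) m) ≫ snd X X := by
  set e := lift (toUnit T ≫ p) (toUnit T ≫ p) ≫ inv (lift (fst X X) m) ≫ snd X X with he
  set b := lift a e ≫ inv (lift (fst X X) m) ≫ snd X X with hb
  have hab : lift a b ≫ m = e := mul_ldiv a e
  have hbe : lift b e ≫ m = b := by rw [he]; exact mul_unit hassoc p b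
  have heb : lift e b ≫ m = b := by rw [he]; exact unit_mul hassoc p b
  have h : lift (lift b a ≫ m) b ≫ m = lift e b ≫ m := by rw [hassoc, hab, hbe, heb]
  have := congrArg (fun c => lift c b ≫ inv (lift m (snd X X)) ≫ fst X X) h
  simpa only [mul_rdiv] using this

end Unit

/-! ### The group object -/

/-- **An associative law with invertible shear maps and a point is a group law** (first rung of Weil's group-chunk theorem,
[EdixhovenRomagny2012] Thm. 2.11 (2)–(5), Thm. 3.28 (2)–(4); Artin 1986 §2 «the group structure … exercise»): in a cartesian
monoidal category, if `m : X ⊗ X ⟶ X` is associative on `T`-points, both shear maps `(pr₁, m)` and `(m, pr₂)` are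
isomorphisms, and `X` has a point `p : 𝟙 ⟶ X`, then `X` is a group object with multiplication `m`.  (On `T`-points `m` is an
associative quasigroup law — an associative quasigroup with an element is a group — naturally in `T`; `X` then represents the
resulting presheaf of groups.) [cite: EdixhovenRomagny2012, Thm. 2.11 (2)-(5)] [cite: Artin1986NeronModels, §2 (after Lemma 2.5)] -/
theorem exists_grpObj_of_isIso_shear (m : X ⊗ X ⟶ X)
    (hassoc : ∀ {T : C} (a b c : T ⟶ X), lift (lift a b ≫ m) c ≫ m = lift a (lift b c ≫ m) ≫ m)
    [IsIso (lift (fst X X) m)] [IsIso (lift m (snd X X))] (p : 𝟙_ C ⟶ X) :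
    ∃ _ : GrpObj X, MonObj.mul (X := X) = m := by
  classical
  -- the group structures on `T`-points
  letI grp : ∀ T : C, Group (T ⟶ X) := fun T =>
    { mul := fun a b => lift a b ≫ m
      mul_assoc := fun a b c => hassoc a b c
      one := lift (toUnit T ≫ p) (toUnit T ≫ p) ≫ inv (lift (fst X X) m) ≫ snd X X
      one_mul := fun a => unit_mul hassoc p a
      mul_one := fun a => mul_unit hassoc p a
      inv := fun a =>
        lift a (lift (toUnit T ≫ p) (toUnit T ≫ p) ≫ inv (lift (fst X X) m) ≫ snd X X) ≫ inv (lift (fst X X) m) ≫ snd X X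
      inv_mul_cancel := fun a => linv_mul hassoc p a }
  -- the presheaf of groups `T ↦ X(T)` and its representability by `X`
  let F : Cᵒᵖ ⥤ GrpCat.{v} :=
    { obj := fun T => GrpCat.of (T.unop ⟶ X)
      map := fun {T T'} g => GrpCat.ofHom (MonoidHom.mk' (fun a : T.unop ⟶ X => g.unop ≫ a) fun a b => by
        change g.unop ≫ (lift a b ≫ m) = lift (g.unop ≫ a) (g.unop ≫ b) ≫ m
        rw [← Category.assoc, comp_lift])
      map_id := fun T => by ext a; exact Category.id_comp a
      map_comp := fun f g => by ext a; exact Category.assoc _ _ _ }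
  let α : (F ⋙ forget GrpCat).RepresentableBy X :=
    { homEquiv := fun {T} => Equiv.refl _
      homEquiv_comp := fun f g => rfl }
  refine ⟨GrpObj.ofRepresentableBy X F α, ?_⟩
  change lift (fst X X) (snd X X) ≫ m = m
  rw [lift_fst_snd, Category.id_comp]

end Literature.AlgebraicGeometry.NeronModels

end
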